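import Mathlib
import Summits.Ventures.PercRepro.TriangleCapBandNoGap

/-!
# PercRepro — THE BAND ON `n` VERTICES AS A FINSET: THE GAPS, THEIR NUMBER, AND THE SIZE OF THE BAND (p3, gen 53;
part 278)

`bandGaps ℓ t` is the finset of values strictly between the top `B(u) + W(u, ℓ)` of a sub-band `u < ⌊t/2⌋` and the
bottom `B(u + 1)` of the next (the intervals are pairwise disjoint: the bottoms increase up to `⌊t/2⌋`, part 275), and
`jmax ℓ t = C(t, 2) − ℓ C(q, 2) − ρ q` the extremal value (`q = ⌊t/ℓ⌋`, `ρ = t mod ℓ`; `two_mul_jmax`).  THEOREM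
(`mem_bandSet_iff`, `2 ≤ ℓ ≤ t`, `2 t ≤ s`): the band value `2 j` is attained on `ℓ + 1 + (s − t)` vertices IFF
`j ∈ bandSet ℓ t := range (jmax ℓ t + 1) \ bandGaps ℓ t` — a gap lies below `⌊t/2⌋` because `B(u + 1) > B(u)` forces
`2 u + 2 < t`, and below the extremal value because every gap is below the attained bottom `B(⌊t/2⌋)`.  So the band has
EXACTLY `jmax ℓ t + 1 − Σ_{u < ⌊t/2⌋} (B(u + 1) − B(u) − W(u, ℓ) − 1)₊` values (`card_bandSet`, `card_bandGaps`);
e.g. `ℓ = 3`, `t = 22`: `162 − (17 + 15 + 12 + 8 + 3) = 107` values, the census of part 268 verbatim.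
Axioms: standard.
-/

namespace PercRepro

namespace TriangleCap

namespace C047

open Finset

/-- The gap after the sub-band `u`: the values strictly between its top and the bottom of the sub-band `u + 1`. -/
def gapAfter (ℓ t u : ℕ) : Finset ℕ := Ico (u * (t - u - 1) + twoW ℓ u / 2 + 1) ((u + 1) * (t - u - 2))

/-- The gaps of the band: the gaps after the sub-bands `u < ⌊t/2⌋`. -/
def bandGaps (ℓ t : ℕ) : Finset ℕ := (range (t / 2)).biUnion (gapAfter ℓ t)

/-- The extremal value of the band (`ℓ ≤ t`): `C(t, 2) − ℓ C(q, 2) − ρ q`, `q = ⌊t/ℓ⌋`, as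
`(t (t − 1) + ℓ q (q + 1) − 2 q t) / 2`. -/
def jmax (ℓ t : ℕ) : ℕ := (t * (t - 1) + ℓ * ((t / ℓ) * (t / ℓ + 1)) - 2 * (t / ℓ) * t) / 2

/-- The band as a finset: the values up to the extremal one, minus the gaps. -/
def bandSet (ℓ t : ℕ) : Finset ℕ := range (jmax ℓ t + 1) \ bandGaps ℓ t

/-- `2 · jmax ℓ t + 2 q t = t (t − 1) + ℓ q (q + 1)` for `2 ≤ ℓ ≤ t` (the extremal value is attained, part 247). -/
theorem two_mul_jmax (ℓ t : ℕ) (hℓ : 2 ≤ ℓ) (hℓt : ℓ ≤ t) :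
    2 * jmax ℓ t + 2 * (t / ℓ) * t = t * (t - 1) + ℓ * ((t / ℓ) * (t / ℓ + 1)) := by
  -- the extremal witness on `ℓ + 1 + (s − t)` vertices with `s = 2 t` gives the parity and the order
  obtain ⟨H, _, j, hfree, hs', ⟨w, hw⟩, hj', hval⟩ :=
    ((vertex_band_extremal ℓ (2 * t) t (by omega) (by omega) le_rfl).2.2.2) hℓt
  unfold jmax
  omega

/-- Membership in the gaps: `j ∈ bandGaps ℓ t` iff for some `u < ⌊t/2⌋`, `2 B(u) + twoW ℓ u < 2 j < 2 B(u + 1)`. -/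
theorem mem_bandGaps (ℓ t j : ℕ) :
    j ∈ bandGaps ℓ t ↔ ∃ u, u < t / 2 ∧
      2 * (u * (t - u - 1)) + twoW ℓ u < 2 * j ∧ j < (u + 1) * (t - u - 2) := by
  unfold bandGaps gapAfter
  simp only [mem_biUnion, mem_range, mem_Ico]
  constructor
  · rintro ⟨u, hu, h1, h2⟩
    obtain ⟨x, hx⟩ := twoW_even ℓ u
    exact ⟨u, hu, by omega, h2⟩
  · rintro ⟨u, hu, h1, h2⟩
    obtain ⟨x, hx⟩ := twoW_even ℓ u
    exact ⟨u, hu, by omega, h2⟩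

/-- A gap at `u` (the bottom `B(u + 1)` above the top of `u`) forces `2 u + 2 < t`. -/
theorem lt_half_of_gap (ℓ t u j : ℕ) (h1 : 2 * (u * (t - u - 1)) + twoW ℓ u < 2 * j)
    (h2 : j < (u + 1) * (t - u - 2)) : u < t / 2 := by
  by_contra hcon
  -- `B(u + 1) ≤ B(u)` when `t ≤ 2 u + 2`
  have hB : (u + 1) * (t - u - 2) ≤ u * (t - u - 1) := by
    rcases Nat.lt_or_ge t (u + 2) with hlt | hge
    · have e : t - u - 2 = 0 := by omega
      rw [e, mul_zero]
      exact Nat.zero_le _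
    · obtain ⟨d, rfl⟩ : ∃ d, t = u + 2 + d := ⟨t - u - 2, by omega⟩
      have e1 : u + 2 + d - u - 2 = d := by omega
      have e2 : u + 2 + d - u - 1 = d + 1 := by omega
      rw [e1, e2]
      have : d ≤ u := by omega
      nlinarith
  omega

/-- **THE BAND AS A FINSET:** for `2 ≤ ℓ ≤ t`, `2 t ≤ s`, the band value `2 j` is attained on `ℓ + 1 + (s − t)` vertices
IFF `j ∈ bandSet ℓ t`. -/
theorem mem_bandSet_iff (ℓ s t j : ℕ) (hℓ : 2 ≤ ℓ) (hℓt : ℓ ≤ t) (hs : 2 * t ≤ s) :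
    (∃ (H : SimpleGraph (Fin (ℓ + 1 + (s - t)))) (_ : DecidableRel H.Adj), H.CliqueFree 3 ∧
      H.edgeFinset.card = s ∧ (∃ w, deg H w + t = s) ∧
      ∑ v, deg H v * deg H v + 2 * (t * (s - t - 1)) + 2 * j = s * (s + 1)) ↔ j ∈ bandSet ℓ t := by
  rw [band_iff_no_gap ℓ s t j hℓ hℓt hs]
  unfold bandSet
  rw [mem_sdiff, mem_range, mem_bandGaps]
  have hjm := two_mul_jmax ℓ t hℓ hℓt
  constructor
  · rintro ⟨hb, hng⟩
    refine ⟨by omega, ?_⟩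
    rintro ⟨u, -, h1, h2⟩
    exact hng u ⟨h1, h2⟩
  · rintro ⟨hb, hng⟩
    refine ⟨by omega, fun u ⟨h1, h2⟩ => hng ⟨u, lt_half_of_gap ℓ t u j h1 h2, h1, h2⟩⟩

/-- The gaps are pairwise disjoint: for `u < u' < ⌊t/2⌋` the gap after `u` ends at `B(u + 1) ≤ B(u')`, below the gap
after `u'`. -/
theorem gapAfter_disjoint (ℓ t : ℕ) : ∀ u ∈ range (t / 2), ∀ u' ∈ range (t / 2), u ≠ u' →
    Disjoint (gapAfter ℓ t u) (gapAfter ℓ t u') := by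
  -- the claim for `u < u'`, then symmetry
  have key : ∀ u u', u < u' → u' < t / 2 → Disjoint (gapAfter ℓ t u) (gapAfter ℓ t u') := by
    intro u u' hlt hu'
    unfold gapAfter
    rw [Finset.disjoint_left]
    intro j hj hj'
    rw [mem_Ico] at hj hj'
    have h1 := bottom_mono t (u + 1) u' hlt (by omega)
    have e : t - (u + 1) - 1 = t - u - 2 := by omega
    rw [e] at h1
    omega
  intro u hu u' hu' hne
  rw [mem_range] at hu hu'
  rcases Nat.lt_or_gt_of_ne hne with h | h
  · exact key u u' h hu'
  · exact (key u' u h hu).symm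

/-- **THE NUMBER OF GAPS:** `|bandGaps ℓ t| = Σ_{u < ⌊t/2⌋} (B(u + 1) − (B(u) + W(u, ℓ) + 1))`. -/
theorem card_bandGaps (ℓ t : ℕ) :
    (bandGaps ℓ t).card =
      ∑ u ∈ range (t / 2), ((u + 1) * (t - u - 2) - (u * (t - u - 1) + twoW ℓ u / 2 + 1)) := by
  unfold bandGaps
  rw [card_biUnion (gapAfter_disjoint ℓ t)]
  apply sum_congr rfl
  intro u _
  unfold gapAfter
  rw [Nat.card_Ico]

/-- The gaps lie below the extremal value: every gap is below the bottom `B(⌊t/2⌋)`, which is attained. -/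
theorem bandGaps_subset_range (ℓ t : ℕ) (hℓ : 2 ≤ ℓ) (hℓt : ℓ ≤ t) : bandGaps ℓ t ⊆ range (jmax ℓ t + 1) := by
  intro j hj
  rw [mem_bandGaps] at hj
  obtain ⟨u, hu, -, h2⟩ := hj
  rw [mem_range]
  -- `j < B(u + 1) ≤ B(⌊t/2⌋) ≤ jmax` (the bottom of the sub-band `⌊t/2⌋` is attained, part 262)
  have h1 := bottom_mono t (u + 1) (t / 2) hu (by omega)
  have e : t - (u + 1) - 1 = t - u - 2 := by omega
  rw [e] at h1
  obtain ⟨H, _, hfree, hs', ⟨w, hw⟩, hval⟩ := bottomWitness ℓ (2 * t) t (t / 2) hℓ (by omega) (by omega) le_rfl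
  have hb := ((vertex_band_extremal ℓ (2 * t) t (by omega) (by omega) le_rfl).1 H hfree hs' w hw _ hval).2.2 hℓt
  have hjm := two_mul_jmax ℓ t hℓ hℓt
  omega

/-- **THE SIZE OF THE BAND:** for `2 ≤ ℓ ≤ t`, `|bandSet ℓ t| = jmax ℓ t + 1 − |bandGaps ℓ t|`. -/
theorem card_bandSet (ℓ t : ℕ) (hℓ : 2 ≤ ℓ) (hℓt : ℓ ≤ t) :
    (bandSet ℓ t).card = jmax ℓ t + 1 - (bandGaps ℓ t).card := by
  unfold bandSet
  rw [card_sdiff, inter_eq_left.mpr (bandGaps_subset_range ℓ t hℓ hℓt), card_range]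

/-- The width with three non-neighbours in closed form (`coll_lfRR_zero` at `k = 2`). -/
theorem twoW_three (u : ℕ) :
    twoW 3 u = u * (u + 1) - (2 * ((u / 2) * (u / 2 - 1)) + 2 * ((u % 2) * (u / 2))) + 2 * (2 - u) := by
  unfold twoW
  rw [coll_lfRR_zero 2 u (by norm_num)]

/-- The census cell `ℓ = 3`, `t = 22`: the extremal value is `161`, the `5` gaps have total length `55`, and the
band has `107` values. -/
theorem card_bandSet_three_twentytwo :
    jmax 3 22 = 161 ∧ (bandGaps 3 22).card = 55 ∧ (bandSet 3 22).card = 107 := by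
  have h1 : jmax 3 22 = 161 := by decide
  have h2 : (bandGaps 3 22).card = 55 := by
    rw [card_bandGaps]
    simp only [Nat.reduceDiv, Finset.sum_range_succ, Finset.sum_range_zero, twoW_three]
  refine ⟨h1, h2, ?_⟩
  rw [card_bandSet 3 22 (by norm_num) (by norm_num), h1, h2]

end C047

end TriangleCap

end PercRepro
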